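import Literature.NumberTheory.LFunctions.PerronTruncated
import Literature.NumberTheory.LFunctions.ExplicitFormulaPsi
import Mathlib.Analysis.SpecialFunctions.Integrals.Basic
import HarnessLib

/-!
# The truncated Perron formula for `ψ₀(x)` (Montgomery–Vaughan Thm. 5.2, Cor. 5.3), general `x`, `T`

Topic: `Literature/NumberTheory/LFunctions`. THEOREMS (everything proved). The first step of the proof
of the truncated explicit formula for `ψ` (Montgomery–Vaughan, *Multiplicative Number Theory I*,
Thm. 12.5, the named fact `Literature.NumberTheory.LFunctions.truncatedExplicitFormula_psi` of
`ExplicitFormulaPsi.lean`): Perron's formula with its remainder, for `a_n = Λ(n)`, `σ₀ = b = 1 + 1/log x`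
and *arbitrary* `x > 1`, `T ≥ 1`,

  **`ψ₀(x) = (1/2πi) ∫_{b−iT}^{b+iT} (−ζ'/ζ)(s) x^s ds/s + R₁`,
  `R₁ ≪_c (log x) min(1, x/(T⟨x⟩)) + (x/T) (log x)²`**   (`x ≥ c > 1`),

`ψ₀(x) = (ψ(x⁺) + ψ(x⁻))/2 = chebyshevPsi₀ x`, `⟨x⟩ = primePowDist x` the distance from `x` to the
nearest prime power other than `x` (`Literature.NumberTheory.LFunctions.PerronPsi.perron_chebyshevPsi₀`; MV p. 400:
"by Theorem 5.2 and its Corollary 5.3, with `σ₀ = 1 + 1/log x`, … `R₁ ≪ ∑_{x/2<n<2x, n≠x} Λ(n)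
min(1, x/(T|x−n|)) + (x/T)∑ Λ(n)/n^{σ₀}` … `≪ (log x) min(1, x/(T⟨x⟩)) + (x/T)(log x)²`").
The tree's `PerronTruncated.lean` has the special case `x = N + 1/2`, `T ≍ x`; the kernel estimate
`Literature.NumberTheory.LFunctions.norm_perronIntegral_sub_le` (`PerronKernel.lean`, MV (5.9) with the
error `y^{σ₀}/(T|log y|)`) is completed here by

* the case `y = 1` of (5.9): `∫_{-T}^{T} dt/(b+it) = 2 arctan(T/b) = π + O(b/T)`
  (`norm_perronIntegral_one_sub_pi_le`), which produces the half weight of the term `n = x`;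
* the alternative `min(1, ·)` of (5.6)/(5.9) near `y = 1` (`norm_perronIntegral_sub_indicator_le_min`),
  from `(y^s − 1)/s = ∫₀^{log y} e^{su} du`;
* Cor. 5.3's `|log(x/n)| ≍ |x − n|/x` on `x/2 < n < 2x` (`min_le_two_mul_min`);

and the elementary estimates of MV p. 400 (`∑_{|n−x|≥1, n<2x} 1/|x − n| ≪ log x`, at most two `n` with
`|n − x| < 1`, each at distance `≥ ⟨x⟩` if it is a prime power, `∑ Λ(n)/n^b ≪ log x`), together with
`ψ(x⁻) = ψ(⌈x⌉ − 1)` (`leftLim_psi`), so that the Perron weights `[n < x] + ½[n = x]` sum to `ψ₀(x)`.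
The interchange of sum and integral is dominated convergence, as in `PerronTruncated.lean`.

## References

* H. L. Montgomery, R. C. Vaughan, *Multiplicative Number Theory I. Classical Theory*, CUP 2007,
  §5.1, Thm. 5.1, Thm. 5.2 (with (5.9)), Cor. 5.3; §12.1, proof of Thm. 12.5 (the estimate of
  `R₁`). [MontgomeryVaughan2007]
-/

noncomputable section

open Complex Set MeasureTheory Filter Topology intervalIntegral Real
open ArithmeticFunction hiding log id
open scoped Chebyshev Interval

namespace Literature.NumberTheory.LFunctions

namespace PerronPsi

/-! ### The kernel at `y = 1`: `∫_{-T}^{T} dt/(b+it) = 2 arctan(T/b) = π + O(b/T)` -/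

/-- `1/(b+it) = (b − it)/(b²+t²)` for real `b ≠ 0`. [folklore] -/
theorem one_div_line_eq {b : ℝ} (hb : 0 < b) (t : ℝ) :
    (1 : ℂ) / ((b : ℂ) + t * I) = ((b : ℂ) - t * I) / ((b : ℂ) ^ 2 + (t : ℂ) ^ 2) := by
  have hd : (b : ℂ) + t * I ≠ 0 := fun h ↦ hb.ne' (by simpa using congrArg Complex.re h)
  have hr : (b ^ 2 + t ^ 2 : ℝ) ≠ 0 := by positivity
  have hD : (b : ℂ) ^ 2 + (t : ℂ) ^ 2 ≠ 0 := by exact_mod_cast hr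
  have hI : I * I = -1 := I_mul_I
  have key : ((b : ℂ) - t * I) * ((b : ℂ) + t * I) = (b : ℂ) ^ 2 + (t : ℂ) ^ 2 := by
    linear_combination (-(t : ℂ) ^ 2) * hI
  rw [div_eq_div_iff hd hD, one_mul, key]

/-- `(b − it)/(b²+t²) = b/(b²+t²) − i·t/(b²+t²)` with real-valued parts. [folklore] -/
theorem sub_div_line_eq {b : ℝ} (hb : 0 < b) (t : ℝ) :
    ((b : ℂ) - t * I) / ((b : ℂ) ^ 2 + (t : ℂ) ^ 2) =
      ((b / (b ^ 2 + t ^ 2) : ℝ) : ℂ) - ((t / (b ^ 2 + t ^ 2) : ℝ) : ℂ) * I := by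
  have hr : (b ^ 2 + t ^ 2 : ℝ) ≠ 0 := by positivity
  have hD : (b : ℂ) ^ 2 + (t : ℂ) ^ 2 ≠ 0 := by exact_mod_cast hr
  push_cast
  field_simp

/-- `∫_{-T}^{T} b dt/(b²+t²) = 2 arctan(T/b)` (`b > 0`). [folklore] -/
theorem integral_re_part {b : ℝ} (hb : 0 < b) (T : ℝ) :
    ∫ t in (-T)..T, b / (b ^ 2 + t ^ 2) = 2 * Real.arctan (T / b) := by
  have hderiv : ∀ t : ℝ, HasDerivAt (fun t ↦ Real.arctan (t / b)) (b / (b ^ 2 + t ^ 2)) t := by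
    intro t
    have h := (Real.hasDerivAt_arctan (t / b)).comp t ((hasDerivAt_id t).div_const b)
    have e : 1 / (1 + (t / b) ^ 2) * (1 / b) = b / (b ^ 2 + t ^ 2) := by
      field_simp
    rwa [e] at h
  have hcont : Continuous fun t : ℝ ↦ b / (b ^ 2 + t ^ 2) :=
    continuous_const.div (by fun_prop) fun t ↦ by positivity
  rw [integral_eq_sub_of_hasDerivAt (fun t _ ↦ hderiv t) (hcont.intervalIntegrable _ _)]
  rw [neg_div, Real.arctan_neg]
  ring

/-- `∫_{-T}^{T} t dt/(b²+t²) = 0` (`b ≠ 0`; odd integrand). [folklore] -/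
theorem integral_im_part {b : ℝ} (hb : 0 < b) (T : ℝ) :
    ∫ t in (-T)..T, t / (b ^ 2 + t ^ 2) = 0 := by
  have hderiv : ∀ t : ℝ, HasDerivAt (fun t ↦ Real.log (b ^ 2 + t ^ 2) / 2) (t / (b ^ 2 + t ^ 2)) t := by
    intro t
    have hpos : 0 < b ^ 2 + t ^ 2 := by positivity
    have h1 : HasDerivAt (fun t : ℝ ↦ b ^ 2 + t ^ 2) (2 * t) t := by
      simpa using ((hasDerivAt_pow 2 t).const_add (b ^ 2))
    have h2 := ((h1.log hpos.ne').div_const 2)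
    have e : 2 * t / (b ^ 2 + t ^ 2) / 2 = t / (b ^ 2 + t ^ 2) := by field_simp
    rwa [e] at h2
  have hcont : Continuous fun t : ℝ ↦ t / (b ^ 2 + t ^ 2) :=
    continuous_id.div (by fun_prop) fun t ↦ by positivity
  rw [integral_eq_sub_of_hasDerivAt (fun t _ ↦ hderiv t) (hcont.intervalIntegrable _ _)]
  simp

/-- **`∫_{-T}^{T} dt/(b+it) = 2 arctan(T/b)`** for `b > 0`. [folklore] -/
theorem integral_one_div_line {b : ℝ} (hb : 0 < b) (T : ℝ) :
    ∫ t in (-T)..T, (1 : ℂ) / ((b : ℂ) + t * I) = ((2 * Real.arctan (T / b) : ℝ) : ℂ) := by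
  have hc1 : Continuous fun t : ℝ ↦ (((b / (b ^ 2 + t ^ 2) : ℝ) : ℂ)) :=
    continuous_ofReal.comp (continuous_const.div (by fun_prop) fun t ↦ by positivity)
  have hc2 : Continuous fun t : ℝ ↦ ((t / (b ^ 2 + t ^ 2) : ℝ) : ℂ) * I :=
    (continuous_ofReal.comp (continuous_id.div (by fun_prop) fun t ↦ by positivity)).mul
      continuous_const
  simp_rw [one_div_line_eq hb, sub_div_line_eq hb]
  rw [intervalIntegral.integral_sub (hc1.intervalIntegrable _ _) (hc2.intervalIntegrable _ _),
    intervalIntegral.integral_mul_const, intervalIntegral.integral_ofReal,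
    intervalIntegral.integral_ofReal, integral_re_part hb, integral_im_part hb]
  simp

/-- **The kernel at `y = 1`**: `|∫_{-T}^{T} dt/(b+it) − π| ≤ 2b/T` (`b, T > 0`), i.e.
`(1/2πi)∫_{b−iT}^{b+iT} ds/s = 1/2 + O(b/T)` (Montgomery–Vaughan (5.9), case `y = 1`).
[cite: MontgomeryVaughan2007, Thm. 5.2 (proof, (5.9))] -/
theorem norm_perronIntegral_one_sub_pi_le {b T : ℝ} (hb : 0 < b) (hT : 0 < T) :
    ‖(∫ t in (-T)..T, (1 : ℂ) ^ ((b : ℂ) + t * I) / ((b : ℂ) + t * I)) - π‖ ≤ 2 * b / T := by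
  simp_rw [one_cpow]
  rw [integral_one_div_line hb T, ← ofReal_sub, Complex.norm_real, Real.norm_eq_abs]
  have hTb : 0 < T / b := div_pos hT hb
  have h1 : Real.arctan (T / b) = π / 2 - Real.arctan (b / T) := by
    have := Real.arctan_inv_of_pos hTb
    rw [inv_div] at this
    linarith
  have h2 : 0 ≤ Real.arctan (b / T) := Real.arctan_nonneg.2 (div_pos hb hT).le
  have h3 : Real.arctan (b / T) ≤ b / T := by
    have h := Real.le_tan h2 (Real.arctan_lt_pi_div_two _)
    rwa [Real.tan_arctan] at h
  rw [h1, show 2 * (π / 2 - Real.arctan (b / T)) - π = -(2 * Real.arctan (b / T)) by ring, abs_neg,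
    abs_of_nonneg (by positivity)]
  calc 2 * Real.arctan (b / T) ≤ 2 * (b / T) := by linarith
    _ = 2 * b / T := by ring

/-! ### The kernel near `y = 1` -/

/-- For `y > 0`, `b > 0` and `s = b + it`: `‖(y^s − 1)/s‖ ≤ |log y| · max(1, y^b)`
(`(y^s − 1)/s = ∫₀^{log y} e^{su} du`). [folklore] -/
theorem norm_cpow_sub_one_div_le {y b : ℝ} (hy : 0 < y) (hb : 0 < b) (t : ℝ) :
    ‖((y : ℂ) ^ ((b : ℂ) + t * I) - 1) / ((b : ℂ) + t * I)‖ ≤ |Real.log y| * max 1 (y ^ b) := by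
  set s : ℂ := (b : ℂ) + t * I with hs
  have hsre : s.re = b := by simp [hs]
  have hs0 : s ≠ 0 := fun h ↦ hb.ne' (by rw [← hsre, h, zero_re])
  have hy_s : (y : ℂ) ^ s = Complex.exp (s * (Real.log y : ℝ)) := by
    rw [cpow_def_of_ne_zero (by exact_mod_cast hy.ne'), ← ofReal_log hy.le, mul_comm]
  -- the integral representation
  have hrep : ((y : ℂ) ^ s - 1) / s = ∫ u in (0 : ℝ)..Real.log y, Complex.exp (s * u) := by
    rw [integral_exp_mul_complex hs0, hy_s]
    simp
  rw [hrep]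
  have hbound : ∀ u ∈ Ι (0 : ℝ) (Real.log y), ‖Complex.exp (s * u)‖ ≤ max 1 (y ^ b) := by
    intro u hu
    rw [Complex.norm_exp]
    have hre : (s * u).re = b * u := by simp [hs]
    rw [hre]
    rcases Set.mem_uIoc.1 hu with ⟨h0, h1⟩ | ⟨h0, h1⟩
    · refine le_trans ?_ (le_max_right _ _)
      rw [Real.rpow_def_of_pos hy]
      exact Real.exp_le_exp.2 (by nlinarith)
    · refine le_trans ?_ (le_max_left _ _)
      rw [← Real.exp_zero]
      exact Real.exp_le_exp.2 (by nlinarith)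
  have h := intervalIntegral.norm_integral_le_of_norm_le_const hbound
  rw [sub_zero] at h
  calc ‖∫ u in (0 : ℝ)..Real.log y, Complex.exp (s * u)‖ ≤ max 1 (y ^ b) * |Real.log y| := h
    _ = |Real.log y| * max 1 (y ^ b) := by rw [mul_comm]

/-- Continuity of `t ↦ 1/(b+it)` (`b ≠ 0`). [folklore] -/
theorem continuous_one_div_line {b : ℝ} (hb : 0 < b) :
    Continuous fun t : ℝ ↦ (1 : ℂ) / ((b : ℂ) + t * I) := by
  refine continuous_const.div (by fun_prop) fun t h ↦ hb.ne' ?_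
  simpa using congrArg Complex.re h

/-- `‖∫_{-T}^{T} y^{b+it}/(b+it) dt − ∫_{-T}^{T} dt/(b+it)‖ ≤ 2T |log y| max(1, y^b)`. [folklore] -/
theorem norm_perronIntegral_sub_one_le {y b T : ℝ} (hy : 0 < y) (hb : 0 < b) (hT : 0 ≤ T) :
    ‖(∫ t in (-T)..T, (y : ℂ) ^ ((b : ℂ) + t * I) / ((b : ℂ) + t * I)) -
        ∫ t in (-T)..T, (1 : ℂ) / ((b : ℂ) + t * I)‖ ≤
      2 * T * (|Real.log y| * max 1 (y ^ b)) := by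
  rw [← intervalIntegral.integral_sub ((continuous_cpow_div_vertical hy hb.ne').intervalIntegrable _ _)
    ((continuous_one_div_line hb).intervalIntegrable _ _)]
  have hpt : ∀ t ∈ Ι (-T) T, ‖(y : ℂ) ^ ((b : ℂ) + t * I) / ((b : ℂ) + t * I) -
      1 / ((b : ℂ) + t * I)‖ ≤ |Real.log y| * max 1 (y ^ b) := by
    intro t _
    rw [div_sub_div_same]
    exact norm_cpow_sub_one_div_le hy hb t
  have h := intervalIntegral.norm_integral_le_of_norm_le_const hpt
  rw [show |T - -T| = 2 * T by rw [sub_neg_eq_add, abs_of_nonneg (by linarith)]; ring] at h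
  linarith

/-- **Perron's kernel with the `min`** (Montgomery–Vaughan (5.9) with (5.6), all `y ≠ 1`): for
`y > 0`, `y ≠ 1`, `b > 0`, `T > 0`,
`|∫_{-T}^{T} y^{b+it}/(b+it) dt − 2π[y>1]| ≤ (2 max(1,y^b) + 2b/T + π) · min(1, 1/(T|log y|))`.
[cite: MontgomeryVaughan2007, Thm. 5.2 (proof, (5.9)), (5.6)] -/
theorem norm_perronIntegral_sub_indicator_le_min {y b T : ℝ} (hy : 0 < y) (hy1 : y ≠ 1)
    (hb : 0 < b) (hT : 0 < T) :
    ‖(∫ t in (-T)..T, (y : ℂ) ^ ((b : ℂ) + t * I) / ((b : ℂ) + t * I)) -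
        (if 1 < y then 2 * π else 0 : ℝ)‖ ≤
      (2 * max 1 (y ^ b) + 2 * b / T + π) * min 1 (1 / (T * |Real.log y|)) := by
  have hℓ : 0 < |Real.log y| := abs_pos.2 (Real.log_ne_zero_of_pos_of_ne_one hy hy1)
  have hmax : 1 ≤ max 1 (y ^ b) := le_max_left _ _
  have hC : 0 ≤ 2 * max 1 (y ^ b) + 2 * b / T + π := by positivity
  set V := ∫ t in (-T)..T, (y : ℂ) ^ ((b : ℂ) + t * I) / ((b : ℂ) + t * I) with hV
  rcases le_or_gt (T * |Real.log y|) 1 with h | h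
  · -- near `y = 1`: compare with the kernel at `1`
    have hmin : min 1 (1 / (T * |Real.log y|)) = 1 :=
      min_eq_left ((one_le_div (by positivity)).2 h)
    rw [hmin, mul_one]
    set V₁ := ∫ t in (-T)..T, (1 : ℂ) / ((b : ℂ) + t * I) with hV₁
    have h1 : ‖V - V₁‖ ≤ 2 * max 1 (y ^ b) := by
      refine (norm_perronIntegral_sub_one_le hy hb hT.le).trans ?_
      calc 2 * T * (|Real.log y| * max 1 (y ^ b)) = 2 * (T * |Real.log y|) * max 1 (y ^ b) := by ring
        _ ≤ 2 * 1 * max 1 (y ^ b) := by gcongr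
        _ = 2 * max 1 (y ^ b) := by ring
    have h2 : ‖V₁ - π‖ ≤ 2 * b / T := by
      have := norm_perronIntegral_one_sub_pi_le hb hT
      simp_rw [one_cpow] at this
      exact this
    have h3 : ‖(π : ℂ) - ((if 1 < y then 2 * π else 0 : ℝ) : ℂ)‖ = π := by
      split_ifs
      · push_cast
        rw [show (π : ℂ) - 2 * π = -π by ring, norm_neg, Complex.norm_real, Real.norm_eq_abs,
          abs_of_pos Real.pi_pos]
      · rw [ofReal_zero, sub_zero, Complex.norm_real, Real.norm_eq_abs, abs_of_pos Real.pi_pos]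
    calc ‖V - ((if 1 < y then 2 * π else 0 : ℝ) : ℂ)‖
        = ‖(V - V₁) + (V₁ - π) + ((π : ℂ) - ((if 1 < y then 2 * π else 0 : ℝ) : ℂ))‖ := by ring_nf
      _ ≤ ‖V - V₁‖ + ‖V₁ - π‖ + ‖(π : ℂ) - ((if 1 < y then 2 * π else 0 : ℝ) : ℂ)‖ := norm_add₃_le
      _ ≤ 2 * max 1 (y ^ b) + 2 * b / T + π := by rw [h3]; gcongr
  · -- away from `y = 1`: the contour estimate of `PerronKernel.lean`
    have hmin : min 1 (1 / (T * |Real.log y|)) = 1 / (T * |Real.log y|) :=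
      min_eq_right ((div_le_one (by positivity)).2 h.le)
    rw [hmin]
    have h0 := norm_perronIntegral_sub_le hy hy1 hb hT hT
    refine h0.trans ?_
    rw [show y ^ b * (1 / T + 1 / T) / |Real.log y| = 2 * y ^ b * (1 / (T * |Real.log y|)) by
      field_simp; ring]
    refine mul_le_mul_of_nonneg_right ?_ (by positivity)
    have : y ^ b ≤ max 1 (y ^ b) := le_max_right _ _
    have : 0 ≤ 2 * b / T := by positivity
    linarith [Real.pi_pos.le]

/-! ### `|log(x/n)| ≫ |x − n|/x` for `x/2 < n < 2x` -/

/-- For `x/2 < n < 2x` (`x > 0`): `|x − n|/(2x) ≤ |log(x/n)|`. [cite: MontgomeryVaughan2007, Cor. 5.3 (proof)] -/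
theorem abs_sub_div_le_abs_log {x n : ℝ} (hx : 0 < x) (h1 : x / 2 < n) (h2 : n < 2 * x) :
    |x - n| / (2 * x) ≤ |Real.log (x / n)| := by
  have hn : 0 < n := by linarith
  rcases le_or_gt n x with hnx | hnx
  · -- `n ≤ x`: `log(x/n) ≥ 1 − n/x = (x−n)/x ≥ (x−n)/(2x)`
    have hy : 1 ≤ x / n := (one_le_div hn).2 hnx
    have hlog : 0 ≤ Real.log (x / n) := Real.log_nonneg hy
    rw [abs_of_nonneg (by linarith), abs_of_nonneg hlog]
    have h := Real.one_sub_inv_le_log_of_pos (div_pos hx hn)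
    rw [inv_div] at h
    have e : 1 - n / x = (x - n) / x := by field_simp
    rw [e] at h
    refine le_trans ?_ h
    rw [div_le_div_iff₀ (by positivity) hx]
    nlinarith
  · -- `n > x`: `|log(x/n)| = log(n/x) ≥ 1 − x/n = (n−x)/n ≥ (n−x)/(2x)`
    have hy : x / n < 1 := (div_lt_one hn).2 hnx
    have hlog : Real.log (x / n) < 0 := Real.log_neg (div_pos hx hn) hy
    rw [abs_of_neg (by linarith), abs_of_neg hlog, ← Real.log_inv, inv_div]
    have h := Real.one_sub_inv_le_log_of_pos (div_pos hn hx)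
    rw [inv_div] at h
    have e : 1 - x / n = (n - x) / n := by field_simp
    rw [e] at h
    refine le_trans ?_ h
    rw [neg_sub, div_le_div_iff₀ (by positivity) hn]
    nlinarith

/-- For `x/2 < n < 2x`, `n ≠ x`, `T > 0`: `min(1, 1/(T|log(x/n)|)) ≤ 2 min(1, x/(T|x−n|))`.
[cite: MontgomeryVaughan2007, Cor. 5.3 (proof)] -/
theorem min_le_two_mul_min {x n T : ℝ} (hx : 0 < x) (h1 : x / 2 < n) (h2 : n < 2 * x)
    (hne : n ≠ x) (hT : 0 < T) :
    min 1 (1 / (T * |Real.log (x / n)|)) ≤ 2 * min 1 (x / (T * |x - n|)) := by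
  have habs : 0 < |x - n| := abs_pos.2 (sub_ne_zero.2 (Ne.symm hne))
  have hlog := abs_sub_div_le_abs_log hx h1 h2
  have hlog0 : 0 < |Real.log (x / n)| := lt_of_lt_of_le (by positivity) hlog
  have key : 1 / (T * |Real.log (x / n)|) ≤ 2 * (x / (T * |x - n|)) := by
    rw [show 2 * (x / (T * |x - n|)) = 1 / (T * (|x - n| / (2 * x))) by field_simp]
    exact one_div_le_one_div_of_le (by positivity) (by gcongr)
  rcases le_or_gt 1 (x / (T * |x - n|)) with h | h
  · rw [min_eq_left h]
    exact (min_le_left _ _).trans (by norm_num)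
  · rw [min_eq_right h.le]
    exact (min_le_right _ _).trans key

/-! ### `ψ₀` and the left limit of `ψ` -/

/-- `ψ(x⁻) = ψ(⌈x⌉ − 1)`: the left limit of the step function `ψ` at `x`. [folklore] -/
theorem leftLim_psi (x : ℝ) : Function.leftLim ψ x = ψ ((⌈x⌉₊ - 1 : ℕ) : ℝ) := by
  refine leftLim_eq_of_tendsto (tendsto_const_nhds.congr' ?_)
  rcases le_or_gt x 0 with hx | hx
  · have hm : (⌈x⌉₊ - 1 : ℕ) = 0 := by rw [Nat.ceil_eq_zero.2 hx]
    filter_upwards [self_mem_nhdsWithin] with t ht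
    rw [hm, Nat.cast_zero, Chebyshev.psi_zero, Chebyshev.psi_eq_zero_of_lt_two]
    exact lt_of_lt_of_le ht (hx.trans (by norm_num))
  · have hceil : 0 < ⌈x⌉₊ := Nat.ceil_pos.2 hx
    have hm1 : (⌈x⌉₊ - 1 : ℕ) + 1 = ⌈x⌉₊ := by omega
    have hm1' : (((⌈x⌉₊ - 1 : ℕ) : ℝ)) + 1 = ⌈x⌉₊ := by exact_mod_cast hm1
    have hmx : (((⌈x⌉₊ - 1 : ℕ) : ℝ)) < x := by
      have h2 := Nat.ceil_lt_add_one hx.le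
      linarith
    filter_upwards [Ico_mem_nhdsLT hmx] with t ht
    have ht0 : 0 ≤ t := le_trans (Nat.cast_nonneg _) ht.1
    have hfl : ⌊t⌋₊ = ⌈x⌉₊ - 1 := by
      rw [Nat.floor_eq_iff ht0]
      refine ⟨ht.1, ?_⟩
      have h2 : x ≤ ⌈x⌉₊ := Nat.le_ceil x
      linarith [ht.2]
    rw [Chebyshev.psi_eq_psi_coe_floor t, hfl]

/-- `ψ₀(x) = (ψ(x) + ψ(⌈x⌉ − 1))/2`. [cite: MontgomeryVaughan2007, §12.1] -/
theorem chebyshevPsi₀_eq (x : ℝ) : chebyshevPsi₀ x = (ψ x + ψ ((⌈x⌉₊ - 1 : ℕ) : ℝ)) / 2 := by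
  rw [chebyshevPsi₀, leftLim_psi]

/-- `∑_{n ≤ N} Λ(n) = ψ(N)` over `Finset.range (N+1)` (`Λ(0) = 0`). [folklore] -/
theorem sum_range_vonMangoldt (N : ℕ) : ∑ n ∈ Finset.range (N + 1), Λ n = ψ (N : ℝ) := by
  rw [Chebyshev.psi, Nat.floor_natCast, Finset.range_eq_Ico,
    Finset.sum_eq_sum_Ico_succ_bot (Nat.succ_pos N)]
  have hIco : Finset.Ico 1 (N + 1) = Finset.Ioc 0 N := by
    ext n; simp only [Finset.mem_Ico, Finset.mem_Ioc]; omega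
  rw [hIco]
  simp

/-- `∑_n Λ(n) w(n) = ψ(x⁻) + ψ(x) = 2ψ₀(x)` for the Perron weight `w(n) = [n < x] + [n ≤ x]` (`2` if
`n < x`, `1` if `n = x`, `0` if `n > x`: twice the weight `[y > 1] + ½[y = 1]` of the kernel at `y = x/n`).
[cite: MontgomeryVaughan2007, Thm. 5.1, §12.1] -/
theorem sum_vonMangoldt_mul_weight {x : ℝ} (hx : 0 < x) :
    ∑ n ∈ Finset.range (⌊x⌋₊ + 1),
      Λ n * ((if (n : ℝ) < x then 1 else 0) + (if (n : ℝ) ≤ x then 1 else 0)) = 2 * chebyshevPsi₀ x := by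
  classical
  have hceil : 0 < ⌈x⌉₊ := Nat.ceil_pos.2 hx
  have hm1 : (⌈x⌉₊ - 1 : ℕ) + 1 = ⌈x⌉₊ := by omega
  simp only [mul_add, Finset.sum_add_distrib, mul_ite, mul_one, mul_zero]
  rw [← Finset.sum_filter, ← Finset.sum_filter]
  have hA : (Finset.range (⌊x⌋₊ + 1)).filter (fun n : ℕ ↦ (n : ℝ) < x) =
      Finset.range ((⌈x⌉₊ - 1 : ℕ) + 1) := by
    ext n
    simp only [Finset.mem_filter, Finset.mem_range]
    rw [hm1]
    constructor
    · rintro ⟨-, h⟩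
      exact Nat.lt_ceil.2 h
    · intro h
      refine ⟨?_, Nat.lt_ceil.1 h⟩
      have := Nat.ceil_le_floor_add_one x
      omega
  have hB : (Finset.range (⌊x⌋₊ + 1)).filter (fun n : ℕ ↦ (n : ℝ) ≤ x) =
      Finset.range (⌊x⌋₊ + 1) := by
    refine Finset.filter_true_of_mem fun n hn ↦ ?_
    rw [Finset.mem_range] at hn
    exact le_trans (by exact_mod_cast Nat.lt_succ_iff.1 hn) (Nat.floor_le hx.le)
  rw [hA, hB, sum_range_vonMangoldt, sum_range_vonMangoldt, chebyshevPsi₀_eq,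
    ← Chebyshev.psi_eq_psi_coe_floor]
  ring

/-! ### Elementary sums for Cor. 5.3 -/

/-- `∑_{n < x, x − n ≥ 1} 1/(x − n) ≤ 1 + log x` (`x ≥ 1`; a harmonic sum). [folklore] -/
theorem sum_inv_sub_left_le {x : ℝ} (hx : 1 ≤ x) (s : Finset ℕ) :
    ∑ n ∈ s.filter (fun n : ℕ ↦ (n : ℝ) < x ∧ 1 ≤ x - n), 1 / (x - n) ≤ 1 + Real.log x := by
  set m := ⌊x⌋₊ with hm
  have hm1 : 1 ≤ m := Nat.le_floor (by simpa using hx)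
  have hm0 : (0 : ℝ) < m := by exact_mod_cast hm1
  have hmx : (m : ℝ) ≤ x := Nat.floor_le (by linarith)
  have hmem : ∀ n ∈ s.filter (fun n : ℕ ↦ (n : ℝ) < x ∧ 1 ≤ x - n), n + 1 ≤ m := by
    intro n hn
    rw [Finset.mem_filter] at hn
    exact Nat.le_floor (by push_cast; linarith [hn.2.2])
  calc ∑ n ∈ s.filter (fun n : ℕ ↦ (n : ℝ) < x ∧ 1 ≤ x - n), 1 / (x - n)
      ≤ ∑ n ∈ s.filter (fun n : ℕ ↦ (n : ℝ) < x ∧ 1 ≤ x - n), 1 / ((m : ℝ) - n) := by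
        refine Finset.sum_le_sum fun n hn ↦ ?_
        have hnm' : (n : ℝ) + 1 ≤ m := by exact_mod_cast hmem n hn
        exact one_div_le_one_div_of_le (by linarith) (by linarith)
    _ ≤ ∑ n ∈ Finset.range m, 1 / ((m : ℝ) - n) := by
        refine Finset.sum_le_sum_of_subset_of_nonneg ?_ ?_
        · intro n hn
          rw [Finset.mem_range]
          have := hmem n hn
          omega
        · intro n hn _
          rw [Finset.mem_range] at hn
          have : (n : ℝ) + 1 ≤ m := by exact_mod_cast hn
          exact div_nonneg zero_le_one (by linarith)
    _ = ∑ i ∈ Finset.Ico 1 (m + 1), 1 / (i : ℝ) := by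
        symm
        rw [Finset.sum_Ico_eq_sum_range, show m + 1 - 1 = m from rfl, ← Finset.sum_range_reflect _ m]
        refine Finset.sum_congr rfl fun j hj ↦ ?_
        rw [Finset.mem_range] at hj
        have e1 : (((1 + (m - 1 - j)) : ℕ) : ℝ) = m - j := by
          rw [Nat.cast_add, Nat.cast_sub (by omega), Nat.cast_sub (by omega)]
          push_cast; ring
        rw [e1]
    _ ≤ 1 + Real.log m := sum_Ico_one_div_le m
    _ ≤ 1 + Real.log x := by linarith [Real.log_le_log hm0 hmx]

/-- `∑_{x < n < 2x, n − x ≥ 1} 1/(n − x) ≤ 2(1 + log(2x+1))` (`x ≥ 0`; a harmonic sum, using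
`1/(n − x) ≤ 2/(n − ⌊x⌋)`). [folklore] -/
theorem sum_inv_sub_right_le {x : ℝ} (hx : 0 ≤ x) (s : Finset ℕ) :
    ∑ n ∈ s.filter (fun n : ℕ ↦ x < n ∧ 1 ≤ (n : ℝ) - x ∧ (n : ℝ) < 2 * x), 1 / ((n : ℝ) - x) ≤
      2 * (1 + Real.log (2 * x + 1)) := by
  set m := ⌊x⌋₊ with hm
  set N := ⌈2 * x⌉₊ with hN
  have hxm : x < m + 1 := Nat.lt_floor_add_one x
  have hmx : (m : ℝ) ≤ x := Nat.floor_le hx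
  have hmem : ∀ n ∈ s.filter (fun n : ℕ ↦ x < n ∧ 1 ≤ (n : ℝ) - x ∧ (n : ℝ) < 2 * x),
      m + 1 ≤ n ∧ n < N ∧ 1 / ((n : ℝ) - x) ≤ 2 / ((n : ℝ) - m) := by
    intro n hn
    rw [Finset.mem_filter] at hn
    obtain ⟨-, h1, h2, h3⟩ := hn
    have hmn : m < n := by exact_mod_cast (lt_of_le_of_lt hmx h1)
    refine ⟨hmn, Nat.lt_ceil.2 h3, ?_⟩
    have hmn' : (m : ℝ) + 1 ≤ n := by exact_mod_cast hmn
    rw [div_le_div_iff₀ (by linarith) (by linarith)]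
    nlinarith
  calc ∑ n ∈ s.filter (fun n : ℕ ↦ x < n ∧ 1 ≤ (n : ℝ) - x ∧ (n : ℝ) < 2 * x), 1 / ((n : ℝ) - x)
      ≤ ∑ n ∈ s.filter (fun n : ℕ ↦ x < n ∧ 1 ≤ (n : ℝ) - x ∧ (n : ℝ) < 2 * x), 2 / ((n : ℝ) - m) :=
        Finset.sum_le_sum fun n hn ↦ (hmem n hn).2.2
    _ ≤ ∑ n ∈ Finset.Ico (m + 1) N, 2 / ((n : ℝ) - m) := by
        refine Finset.sum_le_sum_of_subset_of_nonneg ?_ ?_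
        · intro n hn
          rw [Finset.mem_Ico]
          exact ⟨(hmem n hn).1, (hmem n hn).2.1⟩
        · intro n hn _
          rw [Finset.mem_Ico] at hn
          have : (m : ℝ) + 1 ≤ n := by exact_mod_cast hn.1
          exact div_nonneg zero_le_two (by linarith)
    _ = 2 * ∑ i ∈ Finset.Ico 1 (N - (m + 1) + 1), 1 / (i : ℝ) := by
        rw [Finset.mul_sum, Finset.sum_Ico_eq_sum_range, Finset.sum_Ico_eq_sum_range,
          show N - (m + 1) + 1 - 1 = N - (m + 1) from rfl]
        refine Finset.sum_congr rfl fun j _ ↦ ?_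
        have e : (((m + 1 + j : ℕ)) : ℝ) - m = ((1 + j : ℕ) : ℝ) := by push_cast; ring
        rw [e]; ring
    _ ≤ 2 * (1 + Real.log ((N - (m + 1) : ℕ) : ℝ)) := by
        gcongr
        exact sum_Ico_one_div_le _
    _ ≤ 2 * (1 + Real.log (2 * x + 1)) := by
        gcongr 2 * (1 + ?_)
        rcases Nat.eq_zero_or_pos (N - (m + 1)) with h0 | hpos
        · rw [h0, Nat.cast_zero, Real.log_zero]
          exact Real.log_nonneg (by linarith)
        · refine Real.log_le_log (by exact_mod_cast hpos) ?_
          have h1 : ((N - (m + 1) : ℕ) : ℝ) ≤ N := by exact_mod_cast Nat.sub_le N (m + 1)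
          have h2 : (N : ℝ) < 2 * x + 1 := Nat.ceil_lt_add_one (by linarith)
          linarith

/-- At most two natural numbers lie within distance `< 1` of a real `x ≥ 0`. [folklore] -/
theorem card_filter_abs_sub_lt_one_le {x : ℝ} (hx : 0 ≤ x) (s : Finset ℕ) :
    (s.filter (fun n : ℕ ↦ |x - n| < 1)).card ≤ 2 := by
  classical
  calc (s.filter (fun n : ℕ ↦ |x - n| < 1)).card ≤ ({⌊x⌋₊, ⌊x⌋₊ + 1} : Finset ℕ).card := by
        refine Finset.card_le_card fun n hn ↦ ?_
        rw [Finset.mem_filter] at hn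
        rw [Finset.mem_insert, Finset.mem_singleton]
        have h1 := hn.2
        rw [abs_lt] at h1
        have hfl := Nat.floor_le hx
        have hlt := Nat.lt_floor_add_one x
        have h3' : ⌊x⌋₊ < n + 1 := by exact_mod_cast (by linarith : (⌊x⌋₊ : ℝ) < n + 1)
        have h4' : n < ⌊x⌋₊ + 2 := by exact_mod_cast (by linarith : (n : ℝ) < ⌊x⌋₊ + 2)
        omega
    _ ≤ 2 := Finset.card_le_two

/-- `⟨x⟩ ≤ |x − n|` for a prime power `n ≠ x`. [cite: MontgomeryVaughan2007, Thm. 12.5] -/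
theorem primePowDist_le {x : ℝ} {n : ℕ} (hn : IsPrimePow n) (hne : (n : ℝ) ≠ x) :
    primePowDist x ≤ |x - n| := by
  unfold primePowDist
  exact ciInf_le ⟨0, by rintro _ ⟨k, rfl⟩; exact abs_nonneg _⟩
    (⟨n, hn, hne⟩ : {n : ℕ // IsPrimePow n ∧ (n : ℝ) ≠ x})

/-- `∑ Λ(n)/n^σ ≤ max(1/(σ−1), 1) + K₀` for all `σ > 1` (the tree's bound on `(1, 2]`, extended by
monotonicity in `σ`). [folklore] -/
theorem exists_tsum_vonMangoldt_div_rpow_le' :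
    ∃ K₀ : ℝ, 0 ≤ K₀ ∧ ∀ σ : ℝ, 1 < σ →
      Summable (fun n : ℕ ↦ Λ n / (n : ℝ) ^ σ) ∧
        ∑' n : ℕ, Λ n / (n : ℝ) ^ σ ≤ max (1 / (σ - 1)) 1 + K₀ := by
  obtain ⟨K₀, hK₀, h⟩ := exists_tsum_vonMangoldt_div_rpow_le
  refine ⟨K₀, hK₀, fun σ hσ ↦ ?_⟩
  rcases le_or_gt σ 2 with h2 | h2
  · obtain ⟨hs, ht⟩ := h σ hσ h2
    exact ⟨hs, ht.trans (by gcongr; exact le_max_left _ _)⟩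
  · obtain ⟨hs2, ht2⟩ := h 2 one_lt_two le_rfl
    have hle : ∀ n : ℕ, Λ n / (n : ℝ) ^ σ ≤ Λ n / (n : ℝ) ^ (2 : ℝ) := by
      intro n
      rcases Nat.eq_zero_or_pos n with rfl | hn
      · simp
      · refine div_le_div_of_nonneg_left vonMangoldt_nonneg (by positivity) ?_
        exact Real.rpow_le_rpow_of_exponent_le (by exact_mod_cast hn) h2.le
    have hnn : ∀ n : ℕ, 0 ≤ Λ n / (n : ℝ) ^ σ := fun n ↦
      div_nonneg vonMangoldt_nonneg (Real.rpow_nonneg (Nat.cast_nonneg n) _)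
    have hs : Summable (fun n : ℕ ↦ Λ n / (n : ℝ) ^ σ) := Summable.of_nonneg_of_le hnn hle hs2
    refine ⟨hs, ?_⟩
    calc ∑' n : ℕ, Λ n / (n : ℝ) ^ σ ≤ ∑' n : ℕ, Λ n / (n : ℝ) ^ (2 : ℝ) :=
          Summable.tsum_le_tsum hle hs hs2
      _ ≤ 1 / (2 - 1) + K₀ := ht2
      _ ≤ max (1 / (σ - 1)) 1 + K₀ := by norm_num

/-! ### The truncated Perron formula for `ψ₀` -/

/-- Continuity of the Perron integrand `(−ζ'/ζ)(b+it) x^{b+it}/(b+it)` in `t` (`b > 1`). [folklore] -/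
theorem continuous_perronIntegrand {x b : ℝ} (hx : 0 < x) (hb : 1 < b) :
    Continuous fun t : ℝ ↦ (-deriv riemannZeta (b + t * I) / riemannZeta (b + t * I)) *
      ((x : ℂ) ^ ((b : ℂ) + t * I) / ((b : ℂ) + t * I)) := by
  refine continuous_iff_continuousAt.2 fun t ↦ ?_
  set s : ℂ := (b : ℂ) + t * I with hs
  have hsre : s.re = b := by simp [hs]
  have hs1 : s ≠ 1 := fun h ↦ by have := congrArg Complex.re h; rw [hsre] at this; simp at this; linarith
  have hs0 : s ≠ 0 := fun h ↦ by have := congrArg Complex.re h; rw [hsre] at this; simp at this; linarith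
  have hζ : riemannZeta s ≠ 0 := riemannZeta_ne_zero_of_one_le_re (by rw [hsre]; exact hb.le)
  have h1 : ContinuousAt (fun s : ℂ ↦ (-deriv riemannZeta s / riemannZeta s) * ((x : ℂ) ^ s / s)) s := by
    have hd : DifferentiableAt ℂ (deriv riemannZeta) s :=
      (analyticOn_riemannZeta s (by simpa using hs1)).deriv.differentiableAt
    exact ((hd.neg.div (differentiableAt_riemannZeta hs1) hζ).mul
      (differentiableAt_cpow_div hx hs0)).continuousAt
  exact h1.comp (f := fun t : ℝ ↦ (b : ℂ) + t * I) (Continuous.continuousAt (by fun_prop))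

set_option maxHeartbeats 1600000 in
/-- **The truncated Perron formula for `ψ₀`** (Montgomery–Vaughan Thm. 5.2 with Cor. 5.3, for
`a_n = Λ(n)`, `σ₀ = 1 + 1/log x`, as estimated in the proof of Thm. 12.5): for every `c > 1` there is
`C` such that for `x ≥ c`, `T ≥ 1` and `b = 1 + 1/log x`,
`‖∫_{-T}^{T} (−ζ'/ζ)(b+it) x^{b+it}/(b+it) dt − 2π ψ₀(x)‖ ≤ C((log x) min(1, x/(T⟨x⟩)) + (x/T) log² x)`,
i.e. `ψ₀(x) = (1/2πi)∫_{b−iT}^{b+iT} (−ζ'/ζ)(s) x^s ds/s + R₁`,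
`R₁ ≪ (log x) min(1, x/(T⟨x⟩)) + (x/T)(log x)²`. [cite: MontgomeryVaughan2007, Thm. 12.5 (proof, estimate of R₁)] -/
theorem perron_chebyshevPsi₀ {c : ℝ} (hc : 1 < c) :
    ∃ C : ℝ, 0 < C ∧ ∀ x : ℝ, c ≤ x → ∀ T : ℝ, 1 ≤ T → ∀ b : ℝ, b = 1 + 1 / Real.log x →
      ‖(∫ t in (-T)..T, (-deriv riemannZeta (b + t * I) / riemannZeta (b + t * I)) *
            ((x : ℂ) ^ ((b : ℂ) + t * I) / ((b : ℂ) + t * I))) - 2 * π * chebyshevPsi₀ x‖ ≤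
        C * (Real.log x * min 1 (x / (T * primePowDist x)) + x / T * Real.log x ^ 2) := by
  obtain ⟨K₀, hK₀0, hK₀⟩ := exists_tsum_vonMangoldt_div_rpow_le'
  set lam : ℝ := Real.log c with hlam
  have hlam0 : 0 < lam := Real.log_pos hc
  set μ : ℝ := max 1 (1 / lam) with hμ
  have hμ1 : 1 ≤ μ := le_max_left _ _
  have hμ2 : 1 / lam ≤ μ := le_max_right _ _
  set β : ℝ := (2 : ℝ) ^ (1 + 1 / lam) with hβ
  have hβ0 : 0 ≤ β := by positivity
  set γ : ℝ := 2 * β + 4 * μ + 4 with hγ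
  set A₁ : ℝ := 2 * Real.exp 1 / Real.log 2 * μ ^ 2 * (1 + K₀) with hA₁
  have hlog2 : 0 < Real.log 2 := Real.log_pos one_lt_two
  set C : ℝ := A₁ + 4 * μ ^ 2 + 8 * γ * μ + 48 * γ * μ ^ 2 with hC
  refine ⟨C, by positivity, fun x hx T hT b hb ↦ ?_⟩
  classical
  -- basic facts
  have hx1 : 1 < x := hc.trans_le hx
  have hx0 : 0 < x := by linarith
  set L : ℝ := Real.log x with hL
  have hLlam : lam ≤ L := Real.log_le_log (by linarith) hx
  have hL0 : 0 < L := hlam0.trans_le hLlam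
  have hb1 : 1 < b := by rw [hb]; simp [hL0]
  have hb0 : 0 < b := by linarith
  have hbm1 : 1 / (b - 1) = L := by rw [hb, add_sub_cancel_left, one_div_one_div]
  have hbμ : b ≤ 2 * μ := by
    rw [hb]
    have : 1 / L ≤ 1 / lam := one_div_le_one_div_of_le hlam0 hLlam
    linarith
  have hxb : x ^ b = Real.exp 1 * x := by
    rw [hb, Real.rpow_add hx0, Real.rpow_one, Real.rpow_def_of_pos hx0, ← hL,
      mul_one_div_cancel hL0.ne', mul_comm]
  have hT0 : 0 < T := by linarith
  have hμL : 1 ≤ μ * L := by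
    calc (1 : ℝ) = 1 / lam * lam := by field_simp
      _ ≤ μ * L := mul_le_mul hμ2 hLlam hlam0.le (by positivity)
  have h2b : (2 : ℝ) ^ b ≤ β := by
    rw [hβ]
    refine Real.rpow_le_rpow_of_exponent_le one_le_two ?_
    rw [hb]
    have : 1 / L ≤ 1 / lam := one_div_le_one_div_of_le hlam0 hLlam
    linarith
  -- the pieces of the error budget
  set M : ℝ := min 1 (x / (T * primePowDist x)) with hM
  have hM0 : 0 ≤ M := le_min zero_le_one (by have := primePowDist_pos x; positivity)
  have hM1 : M ≤ 1 := min_le_left _ _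
  set P : ℝ := x / T * L ^ 2 with hP
  have hP0 : 0 ≤ P := by positivity
  have hxT : 0 ≤ x / T := by positivity
  -- the termwise data
  set F : ℕ → ℝ → ℂ := fun n t ↦
    (Λ n : ℂ) * ((((x / n : ℝ)) : ℂ) ^ ((b : ℂ) + t * I) / ((b : ℂ) + t * I)) with hF
  set f : ℝ → ℂ := fun t ↦ (-deriv riemannZeta (b + t * I) / riemannZeta (b + t * I)) *
    ((x : ℂ) ^ ((b : ℂ) + t * I) / ((b : ℂ) + t * I)) with hf
  -- summability of the dominating series
  obtain ⟨hsumb, htsumb⟩ := hK₀ b hb1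
  have hbsum : Summable fun n : ℕ ↦ Λ n * (x / n) ^ b / b := by
    have := hsumb.mul_left (x ^ b / b)
    refine this.congr fun n ↦ ?_
    rw [Real.div_rpow hx0.le (Nat.cast_nonneg n)]
    field_simp
  -- (1) termwise integration
  have hDCT : HasSum (fun n ↦ ∫ t in (-T)..T, F n t) (∫ t in (-T)..T, f t) := by
    refine intervalIntegral.hasSum_integral_of_dominated_convergence
      (fun n _ ↦ Λ n * (x / n) ^ b / b)
      (fun n ↦ (continuous_perronTerm hx0 hb0 n).aestronglyMeasurable)
      (fun n ↦ Eventually.of_forall fun t _ ↦ norm_perronTerm_le hx0 hb0 n t)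
      (Eventually.of_forall fun t _ ↦ hbsum) intervalIntegrable_const
      (Eventually.of_forall fun t _ ↦ ?_)
    have hs : 1 < ((b : ℂ) + t * I).re := by simp; linarith
    exact hasSum_vonMangoldt_mul_cpow_div hx0 hs
  have hFint : ∀ n, ∫ t in (-T)..T, F n t = (Λ n : ℂ) *
      ∫ t in (-T)..T, ((((x / n : ℝ)) : ℂ) ^ ((b : ℂ) + t * I) / ((b : ℂ) + t * I)) :=
    fun n ↦ intervalIntegral.integral_const_mul _ _
  -- (2) the main term
  set ind : ℕ → ℂ := fun n ↦ (Λ n : ℂ) *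
    ((π * ((if (n : ℝ) < x then 1 else 0) + (if (n : ℝ) ≤ x then 1 else 0)) : ℝ) : ℂ) with hind
  have hind0 : ∀ n ∉ Finset.range (⌊x⌋₊ + 1), ind n = 0 := by
    intro n hn
    rw [Finset.mem_range, not_lt] at hn
    have hxn : x < n := lt_of_lt_of_le (Nat.lt_floor_add_one x) (by exact_mod_cast hn)
    simp [hind, not_lt.2 hxn.le, not_le.2 hxn]
  have hindsum : HasSum ind (2 * π * chebyshevPsi₀ x) := by
    have h : HasSum ind (∑ n ∈ Finset.range (⌊x⌋₊ + 1), ind n) := hasSum_sum_of_ne_finset_zero hind0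
    have hval : ∑ n ∈ Finset.range (⌊x⌋₊ + 1), ind n = 2 * π * chebyshevPsi₀ x := by
      have : ∑ n ∈ Finset.range (⌊x⌋₊ + 1), ind n =
          ((π * ∑ n ∈ Finset.range (⌊x⌋₊ + 1),
            Λ n * ((if (n : ℝ) < x then 1 else 0) + (if (n : ℝ) ≤ x then 1 else 0)) : ℝ) : ℂ) := by
        rw [Finset.mul_sum, ofReal_sum]
        refine Finset.sum_congr rfl fun n _ ↦ ?_
        simp only [hind]; push_cast; ring
      rw [this, sum_vonMangoldt_mul_weight hx0]
      push_cast; ring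
    rwa [hval] at h
  -- (3) the majorant
  set Cb : ℝ := 2 * (2 : ℝ) ^ b + 2 * b / T + π with hCb
  have hCb0 : 0 ≤ Cb := by positivity
  have hCbγ : Cb ≤ γ := by
    rw [hCb, hγ]
    have h1 : 2 * b / T ≤ 2 * b := by
      rw [div_le_iff₀ hT0]; nlinarith
    have h2 : π ≤ 4 := Real.pi_le_four
    nlinarith
  set e₁ : ℕ → ℝ := fun n ↦ (x / n) ^ b * (2 / T) / Real.log 2 with he₁
  set e₂ : ℕ → ℝ := fun n ↦ if (n : ℝ) = x then 2 * b / T else 0 with he₂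
  set e₃ : ℕ → ℝ := fun n ↦ if x / 2 < n ∧ (n : ℝ) < 2 * x ∧ (n : ℝ) ≠ x then
    Cb * (2 * min 1 (x / (T * |x - n|))) else 0 with he₃
  have he₁0 : ∀ n, 0 ≤ e₁ n := fun n ↦ by positivity
  have he₂0 : ∀ n, 0 ≤ e₂ n := fun n ↦ by simp only [he₂]; split_ifs <;> positivity
  have he₃0 : ∀ n, 0 ≤ e₃ n := fun n ↦ by
    simp only [he₃]; split_ifs
    · exact mul_nonneg hCb0 (mul_nonneg zero_le_two (le_min zero_le_one (by positivity)))
    · exact le_rfl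
  set g : ℕ → ℝ := fun n ↦ Λ n * (e₁ n + e₂ n + e₃ n) with hg
  have hg0 : ∀ n, 0 ≤ g n := fun n ↦ mul_nonneg vonMangoldt_nonneg (by linarith [he₁0 n, he₂0 n, he₃0 n])
  -- (4) the termwise error bound
  have herr : ∀ n, ‖(∫ t in (-T)..T, F n t) - ind n‖ ≤ g n := by
    intro n
    rcases Nat.eq_zero_or_pos n with rfl | hn0
    · simp [hFint, hind, hg]
    have hn' : (0 : ℝ) < n := by exact_mod_cast hn0
    have hy0 : 0 < x / n := div_pos hx0 hn'
    have hΛ : 0 ≤ Λ n := vonMangoldt_nonneg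
    rw [hFint, hind, ← mul_sub, norm_mul, Complex.norm_real, Real.norm_eq_abs, abs_of_nonneg hΛ, hg]
    refine mul_le_mul_of_nonneg_left ?_ hΛ
    by_cases hnx : (n : ℝ) = x
    · -- `n = x`: the kernel at `y = 1`
      have hy1 : x / (n : ℝ) = 1 := by rw [hnx, div_self hx0.ne']
      have hw : π * ((if (n : ℝ) < x then 1 else 0) + (if (n : ℝ) ≤ x then 1 else 0)) = π := by
        simp [hnx]
      rw [hw, hy1]
      have h := norm_perronIntegral_one_sub_pi_le hb0 hT0
      push_cast at h ⊢
      refine h.trans ?_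
      have : e₂ n = 2 * b / T := by simp [he₂, hnx]
      linarith [he₁0 n, he₃0 n]
    · have hy1 : x / (n : ℝ) ≠ 1 := fun h ↦ hnx (by rw [div_eq_one_iff_eq hn'.ne'] at h; exact h.symm)
      have hw : π * ((if (n : ℝ) < x then 1 else 0) + (if (n : ℝ) ≤ x then 1 else 0)) =
          if 1 < x / (n : ℝ) then 2 * π else 0 := by
        rcases lt_or_gt_of_ne hnx with h | h
        · have h1 : 1 < x / (n : ℝ) := by rw [one_lt_div hn']; exact h
          simp [h, h.le, h1]; ring
        · have h1 : ¬ 1 < x / (n : ℝ) := by rw [one_lt_div hn', not_lt]; exact h.le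
          simp [not_lt.2 h.le, not_le.2 h, h1]
      rw [hw]
      by_cases hnear : x / 2 < n ∧ (n : ℝ) < 2 * x
      · -- `x/2 < n < 2x`: the kernel with the `min`
        have h := norm_perronIntegral_sub_indicator_le_min hy0 hy1 hb0 hT0
        refine h.trans ?_
        have hyb : (x / n) ^ b ≤ (2 : ℝ) ^ b := by
          refine Real.rpow_le_rpow hy0.le ?_ hb0.le
          rw [div_le_iff₀ hn']; linarith [hnear.1]
        have hmax : max 1 ((x / n) ^ b) ≤ (2 : ℝ) ^ b :=
          max_le (Real.one_le_rpow one_le_two hb0.le) hyb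
        have hmin := min_le_two_mul_min hx0 hnear.1 hnear.2 hnx hT0
        have he3 : e₃ n = Cb * (2 * min 1 (x / (T * |x - n|))) := by simp [he₃, hnear.1, hnear.2, hnx]
        calc (2 * max 1 ((x / n) ^ b) + 2 * b / T + π) * min 1 (1 / (T * |Real.log (x / n)|))
            ≤ Cb * (2 * min 1 (x / (T * |x - n|))) := by
              refine mul_le_mul (by rw [hCb]; linarith) hmin (le_min zero_le_one (by positivity)) hCb0
          _ = e₃ n := he3.symm
          _ ≤ e₁ n + e₂ n + e₃ n := by linarith [he₁0 n, he₂0 n]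
      · -- `n ≤ x/2` or `n ≥ 2x`: `|log y| ≥ log 2`
        have h := norm_perronIntegral_sub_le hy0 hy1 hb0 hT0 hT0
        refine h.trans ?_
        have hlogy : Real.log 2 ≤ |Real.log (x / n)| := by
          rw [not_and_or, not_lt, not_lt] at hnear
          rcases hnear with h2 | h2
          · -- y ≥ 2
            have hy2 : 2 ≤ x / n := by rw [le_div_iff₀ hn']; linarith
            rw [abs_of_pos (Real.log_pos (by linarith))]
            exact Real.log_le_log two_pos hy2
          · -- y ≤ 1/2
            have hy2 : x / n ≤ 1 / 2 := by rw [div_le_iff₀ hn']; linarith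
            have hlt : Real.log (x / n) < 0 := Real.log_neg hy0 (by linarith)
            rw [abs_of_neg hlt]
            have := Real.log_le_log hy0 hy2
            rw [one_div, Real.log_inv] at this
            linarith
        calc (x / n) ^ b * (1 / T + 1 / T) / |Real.log (x / n)|
            ≤ (x / n) ^ b * (1 / T + 1 / T) / Real.log 2 :=
              div_le_div_of_nonneg_left (by positivity) hlog2 hlogy
          _ = e₁ n := by simp only [he₁]; ring
          _ ≤ e₁ n + e₂ n + e₃ n := by linarith [he₂0 n, he₃0 n]
  -- (5) partial sums of the majorant
  have hΛle : ∀ n : ℕ, (n : ℝ) < 2 * x → Λ n ≤ Real.log (2 * x) := by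
    intro n hn
    rcases Nat.eq_zero_or_pos n with rfl | hn0
    · simp only [ArithmeticFunction.map_zero]; exact Real.log_nonneg (by linarith)
    · exact vonMangoldt_le_log.trans (Real.log_le_log (by exact_mod_cast hn0) hn.le)
  have hLμL : L ≤ μ * L := le_mul_of_one_le_left hL0.le hμ1
  have hlog2x : Real.log (2 * x) ≤ 2 * μ * L := by
    rw [Real.log_mul two_ne_zero hx0.ne', ← hL]
    have : Real.log 2 < 1 := by have := Real.log_two_lt_d9; linarith
    linarith
  have hlog2x0 : 0 ≤ Real.log (2 * x) := Real.log_nonneg (by linarith)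
  have hlog2x1 : 1 + Real.log (2 * x + 1) ≤ 4 * μ * L := by
    have h3 : Real.log (2 * x + 1) ≤ Real.log 3 + L := by
      rw [hL, ← Real.log_mul (by norm_num) hx0.ne']
      exact Real.log_le_log (by linarith) (by linarith)
    have h3' : Real.log 3 < 2 := by
      have h9 : (3 : ℝ) < Real.exp 2 := by
        have h := Real.exp_one_gt_d9
        have : Real.exp 2 = Real.exp 1 * Real.exp 1 := by rw [← Real.exp_add]; norm_num
        nlinarith
      have : Real.log 3 < Real.log (Real.exp 2) := Real.log_lt_log (by norm_num) h9
      rwa [Real.log_exp] at this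
    linarith
  -- (5a) `e₁`
  have hS1 : ∀ s : Finset ℕ, ∑ n ∈ s, Λ n * e₁ n ≤ A₁ * P := by
    intro s
    have h1 : ∑ n ∈ s, Λ n * e₁ n = (2 / (T * Real.log 2) * x ^ b) * ∑ n ∈ s, Λ n / (n : ℝ) ^ b := by
      rw [Finset.mul_sum]
      refine Finset.sum_congr rfl fun n _ ↦ ?_
      simp only [he₁]
      rw [Real.div_rpow hx0.le (Nat.cast_nonneg n)]
      field_simp
    rw [h1]
    have h2 : ∑ n ∈ s, Λ n / (n : ℝ) ^ b ≤ μ * L + K₀ := by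
      refine (hsumb.sum_le_tsum s fun n _ ↦ div_nonneg vonMangoldt_nonneg
        (Real.rpow_nonneg (Nat.cast_nonneg n) _)).trans (htsumb.trans ?_)
      rw [hbm1]
      have : max L 1 ≤ μ * L := max_le (by nlinarith) hμL
      linarith
    calc 2 / (T * Real.log 2) * x ^ b * ∑ n ∈ s, Λ n / (n : ℝ) ^ b
        ≤ 2 / (T * Real.log 2) * x ^ b * (μ * L + K₀) :=
          mul_le_mul_of_nonneg_left h2 (by positivity)
      _ = 2 * Real.exp 1 / Real.log 2 * (x / T) * (μ * L + K₀) := by rw [hxb]; field_simp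
      _ ≤ 2 * Real.exp 1 / Real.log 2 * (x / T) * (μ * L * (μ * L) + K₀ * (μ * L) * (μ * L)) := by
          refine mul_le_mul_of_nonneg_left ?_ (by positivity)
          have hKL : K₀ ≤ K₀ * (μ * L) * (μ * L) := by
            have : K₀ * 1 ≤ K₀ * (μ * L) := mul_le_mul_of_nonneg_left hμL hK₀0
            nlinarith
          nlinarith
      _ = A₁ * P := by rw [hA₁, hP]; ring
  -- (5b) `e₂`
  have hS2 : ∀ s : Finset ℕ, ∑ n ∈ s, Λ n * e₂ n ≤ 4 * μ ^ 2 * P := by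
    intro s
    have h1 : ∑ n ∈ s, Λ n * e₂ n = ∑ n ∈ s.filter (fun n : ℕ ↦ (n : ℝ) = x), Λ n * (2 * b / T) := by
      rw [Finset.sum_filter]
      refine Finset.sum_congr rfl fun n _ ↦ ?_
      simp only [he₂]; split_ifs <;> simp
    have hcard : (s.filter (fun n : ℕ ↦ (n : ℝ) = x)).card ≤ 1 := by
      refine Finset.card_le_one.2 fun a ha b' hb' ↦ ?_
      rw [Finset.mem_filter] at ha hb'
      exact_mod_cast (ha.2.trans hb'.2.symm)
    have h2 : ∑ n ∈ s.filter (fun n : ℕ ↦ (n : ℝ) = x), Λ n * (2 * b / T) ≤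
        (s.filter (fun n : ℕ ↦ (n : ℝ) = x)).card • (L * (2 * b / T)) := by
      refine Finset.sum_le_card_nsmul _ _ _ fun n hn ↦ ?_
      rw [Finset.mem_filter] at hn
      refine mul_le_mul_of_nonneg_right ?_ (by positivity)
      have hn0 : n ≠ 0 := by rintro rfl; simp at hn; linarith
      calc Λ n ≤ Real.log n := vonMangoldt_le_log
        _ = L := by rw [hn.2]
    rw [h1]
    refine h2.trans ?_
    calc (s.filter (fun n : ℕ ↦ (n : ℝ) = x)).card • (L * (2 * b / T)) ≤ 1 • (L * (2 * b / T)) := by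
          exact nsmul_le_nsmul_left (by positivity) hcard
      _ = 2 * b * (L / T) := by rw [one_nsmul]; ring
      _ ≤ 2 * (2 * μ) * (x / T * L * (μ * L)) := by
          have hLT : L / T ≤ x / T * L := by
            rw [div_mul_eq_mul_div, div_le_div_iff_of_pos_right hT0]; nlinarith
          have hLT' : x / T * L ≤ x / T * L * (μ * L) := by
            have : x / T * L * 1 ≤ x / T * L * (μ * L) := mul_le_mul_of_nonneg_left hμL (by positivity)
            linarith
          have : 0 ≤ L / T := by positivity
          nlinarith
      _ = 4 * μ ^ 2 * P := by rw [hP]; ring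
  -- (5c) `e₃`
  have hS3 : ∀ s : Finset ℕ, ∑ n ∈ s, Λ n * e₃ n ≤ 8 * γ * μ * (L * M) + 48 * γ * μ ^ 2 * P := by
    intro s
    set cond : ℕ → Prop := fun n ↦ x / 2 < n ∧ (n : ℝ) < 2 * x ∧ (n : ℝ) ≠ x with hcond
    have h1 : ∑ n ∈ s, Λ n * e₃ n =
        2 * Cb * ∑ n ∈ s.filter cond, Λ n * min 1 (x / (T * |x - n|)) := by
      rw [Finset.mul_sum, Finset.sum_filter]
      refine Finset.sum_congr rfl fun n _ ↦ ?_
      simp only [he₃]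
      split_ifs <;> ring
    rw [h1]
    -- split the window at `|x - n| < 1`
    set S := s.filter cond with hS
    have hnear : ∑ n ∈ S.filter (fun n : ℕ ↦ |x - n| < 1), Λ n * min 1 (x / (T * |x - n|)) ≤
        2 * (Real.log (2 * x) * M) := by
      have hterm : ∀ n ∈ S.filter (fun n : ℕ ↦ |x - n| < 1),
          Λ n * min 1 (x / (T * |x - n|)) ≤ Real.log (2 * x) * M := by
        intro n hn
        rw [Finset.mem_filter, hS, Finset.mem_filter] at hn
        obtain ⟨⟨-, h1, h2, h3⟩, -⟩ := hn
        by_cases hΛ0 : Λ n = 0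
        · rw [hΛ0, zero_mul]; positivity
        · have hpp : IsPrimePow n := vonMangoldt_ne_zero_iff.1 hΛ0
          have hd := primePowDist_le hpp h3
          have hd0 := primePowDist_pos x
          refine mul_le_mul (hΛle n h2) ?_ (le_min zero_le_one (by positivity)) hlog2x0
          exact min_le_min_left _ (by gcongr)
      calc ∑ n ∈ S.filter (fun n : ℕ ↦ |x - n| < 1), Λ n * min 1 (x / (T * |x - n|))
          ≤ (S.filter (fun n : ℕ ↦ |x - n| < 1)).card • (Real.log (2 * x) * M) :=
            Finset.sum_le_card_nsmul _ _ _ hterm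
        _ ≤ 2 • (Real.log (2 * x) * M) :=
            nsmul_le_nsmul_left (by positivity) (card_filter_abs_sub_lt_one_le hx0.le S)
        _ = 2 * (Real.log (2 * x) * M) := by rw [two_nsmul]; ring
    have hfar : ∑ n ∈ S.filter (fun n : ℕ ↦ ¬ |x - n| < 1), Λ n * min 1 (x / (T * |x - n|)) ≤
        Real.log (2 * x) * (x / T) * (3 * (1 + Real.log (2 * x + 1))) := by
      set S' := S.filter (fun n : ℕ ↦ ¬ |x - n| < 1) with hS'
      have hmemS' : ∀ n ∈ S', cond n ∧ 1 ≤ |x - n| := by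
        intro n hn
        rw [hS', Finset.mem_filter, hS, Finset.mem_filter, not_lt] at hn
        exact ⟨hn.1.2, hn.2⟩
      have hterm : ∀ n ∈ S', Λ n * min 1 (x / (T * |x - n|)) ≤
          Real.log (2 * x) * (x / T) * (1 / |x - n|) := by
        intro n hn
        obtain ⟨⟨h1, h2, h3⟩, h4⟩ := hmemS' n hn
        have : min 1 (x / (T * |x - n|)) ≤ x / T * (1 / |x - n|) := by
          refine (min_le_right _ _).trans (le_of_eq ?_)
          field_simp
        calc Λ n * min 1 (x / (T * |x - n|)) ≤ Real.log (2 * x) * (x / T * (1 / |x - n|)) :=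
              mul_le_mul (hΛle n h2) this (le_min zero_le_one (by positivity)) hlog2x0
          _ = Real.log (2 * x) * (x / T) * (1 / |x - n|) := by ring
      have hsum : ∑ n ∈ S', 1 / |x - (n : ℝ)| ≤ 3 * (1 + Real.log (2 * x + 1)) := by
        rw [← Finset.sum_filter_add_sum_filter_not S' (fun n : ℕ ↦ (n : ℝ) < x)]
        have hleft : ∑ n ∈ S'.filter (fun n : ℕ ↦ (n : ℝ) < x), 1 / |x - (n : ℝ)| ≤ 1 + Real.log x := by
          have hall : ∀ n ∈ S'.filter (fun n : ℕ ↦ (n : ℝ) < x), (n : ℝ) < x ∧ 1 ≤ x - n := by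
            intro n hn
            rw [Finset.mem_filter] at hn
            have h := (hmemS' n hn.1).2
            rw [abs_of_pos (by linarith [hn.2])] at h
            exact ⟨hn.2, h⟩
          calc ∑ n ∈ S'.filter (fun n : ℕ ↦ (n : ℝ) < x), 1 / |x - (n : ℝ)|
              = ∑ n ∈ S'.filter (fun n : ℕ ↦ (n : ℝ) < x), 1 / (x - n) :=
                Finset.sum_congr rfl fun n hn ↦ by rw [abs_of_pos (by linarith [(hall n hn).2])]
            _ = ∑ n ∈ (S'.filter (fun n : ℕ ↦ (n : ℝ) < x)).filter
                  (fun n : ℕ ↦ (n : ℝ) < x ∧ 1 ≤ x - n), 1 / (x - n) := by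
                rw [Finset.filter_true_of_mem hall]
            _ ≤ 1 + Real.log x := sum_inv_sub_left_le hx1.le _
        have hright : ∑ n ∈ S'.filter (fun n : ℕ ↦ ¬ (n : ℝ) < x), 1 / |x - (n : ℝ)| ≤
            2 * (1 + Real.log (2 * x + 1)) := by
          have hall : ∀ n ∈ S'.filter (fun n : ℕ ↦ ¬ (n : ℝ) < x),
              x < n ∧ 1 ≤ (n : ℝ) - x ∧ (n : ℝ) < 2 * x := by
            intro n hn
            rw [Finset.mem_filter, not_lt] at hn
            obtain ⟨⟨h1, h2, h3⟩, h4⟩ := hmemS' n hn.1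
            have hxn : x < n := lt_of_le_of_ne hn.2 (Ne.symm h3)
            rw [abs_of_neg (by linarith)] at h4
            exact ⟨hxn, by linarith, h2⟩
          calc ∑ n ∈ S'.filter (fun n : ℕ ↦ ¬ (n : ℝ) < x), 1 / |x - (n : ℝ)|
              = ∑ n ∈ S'.filter (fun n : ℕ ↦ ¬ (n : ℝ) < x), 1 / ((n : ℝ) - x) :=
                Finset.sum_congr rfl fun n hn ↦ by
                  rw [abs_of_neg (by linarith [(hall n hn).1]), neg_sub]
            _ = ∑ n ∈ (S'.filter (fun n : ℕ ↦ ¬ (n : ℝ) < x)).filter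
                  (fun n : ℕ ↦ x < n ∧ 1 ≤ (n : ℝ) - x ∧ (n : ℝ) < 2 * x), 1 / ((n : ℝ) - x) := by
                rw [Finset.filter_true_of_mem hall]
            _ ≤ 2 * (1 + Real.log (2 * x + 1)) := sum_inv_sub_right_le hx0.le _
        have hlx : Real.log x ≤ Real.log (2 * x + 1) := Real.log_le_log hx0 (by linarith)
        linarith
      calc ∑ n ∈ S', Λ n * min 1 (x / (T * |x - n|))
          ≤ ∑ n ∈ S', Real.log (2 * x) * (x / T) * (1 / |x - n|) := Finset.sum_le_sum hterm
        _ = Real.log (2 * x) * (x / T) * ∑ n ∈ S', 1 / |x - (n : ℝ)| := by rw [Finset.mul_sum]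
        _ ≤ Real.log (2 * x) * (x / T) * (3 * (1 + Real.log (2 * x + 1))) :=
            mul_le_mul_of_nonneg_left hsum (by positivity)
    rw [← Finset.sum_filter_add_sum_filter_not S (fun n : ℕ ↦ |x - n| < 1)]
    have hsum2 := add_le_add hnear hfar
    calc 2 * Cb * (∑ n ∈ S.filter (fun n : ℕ ↦ |x - n| < 1), Λ n * min 1 (x / (T * |x - n|)) +
          ∑ n ∈ S.filter (fun n : ℕ ↦ ¬ |x - n| < 1), Λ n * min 1 (x / (T * |x - n|)))
        ≤ 2 * γ * (2 * (Real.log (2 * x) * M) +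
            Real.log (2 * x) * (x / T) * (3 * (1 + Real.log (2 * x + 1)))) := by
          refine mul_le_mul (by linarith) hsum2 ?_ (by positivity)
          positivity
      _ ≤ 2 * γ * (2 * (2 * μ * L * M) + 2 * μ * L * (x / T) * (3 * (4 * μ * L))) := by
          have hγ0 : 0 ≤ γ := by positivity
          refine mul_le_mul_of_nonneg_left ?_ (by positivity)
          have h1 : Real.log (2 * x) * M ≤ 2 * μ * L * M := mul_le_mul_of_nonneg_right hlog2x hM0
          have h2 : Real.log (2 * x) * (x / T) * (3 * (1 + Real.log (2 * x + 1))) ≤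
              2 * μ * L * (x / T) * (3 * (4 * μ * L)) := by
            refine mul_le_mul (mul_le_mul_of_nonneg_right hlog2x hxT) (by linarith) ?_ (by positivity)
            have : 0 ≤ Real.log (2 * x + 1) := Real.log_nonneg (by linarith)
            positivity
          linarith
      _ = 8 * γ * μ * (L * M) + 48 * γ * μ ^ 2 * P := by rw [hP]; ring
  -- (6) summation
  have hbound : ∀ s : Finset ℕ, ∑ n ∈ s, g n ≤ C * (L * M + P) := by
    intro s
    have : ∑ n ∈ s, g n = ∑ n ∈ s, Λ n * e₁ n + ∑ n ∈ s, Λ n * e₂ n + ∑ n ∈ s, Λ n * e₃ n := by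
      rw [← Finset.sum_add_distrib, ← Finset.sum_add_distrib]
      refine Finset.sum_congr rfl fun n _ ↦ ?_
      simp only [hg]; ring
    rw [this]
    have hLM : 0 ≤ L * M := by positivity
    have h := add_le_add (add_le_add (hS1 s) (hS2 s)) (hS3 s)
    refine h.trans ?_
    rw [hC]
    have hγ0 : 0 ≤ γ := by positivity
    nlinarith [mul_nonneg hγ0 hLM, mul_nonneg (by positivity : (0:ℝ) ≤ A₁) hLM,
      mul_nonneg (by positivity : (0:ℝ) ≤ μ ^ 2) hLM, mul_nonneg (by positivity : (0:ℝ) ≤ γ * μ) hP0,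
      mul_nonneg (by positivity : (0:ℝ) ≤ γ * μ ^ 2) hLM]
  have hgsum : Summable g := summable_of_sum_le hg0 hbound
  have hgtsum : ∑' n, g n ≤ C * (L * M + P) := Real.tsum_le_of_sum_le hg0 hbound
  have hmain := (hDCT.sub hindsum).norm_le_of_bounded hgsum.hasSum herr
  exact hmain.trans hgtsum

end PerronPsi

end Literature.NumberTheory.LFunctions

end
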